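import Summits.QuantumFields.BalabanUV.Beta.WardBorderReflectionContactAxis

/-!
# `BalabanUV.Beta.WardBorderReflectionContactAxisMirror` — binder row D1, (L4): «D1-hRhW-SOCKET-CONSISTENCY» part 2b′ — the MIRROR AXIS BLOCK
# `(x, inr α; z, inl β)` of part 2b's consistency identity for the canonical contact

HONEST FRAMING (cell charter, verbatim): «discharging BetaPertH makes Balaban's UV stability UNCONDITIONAL — a real
constructive-QFT result; it is NOT the continuum limit and NOT the Clay problem.»  Neutral [folklore] algebra, legs exchanged with respect to
`WardBorderReflectionContactAxis.canonD_ward_eq_defect_inl_inr_axis`: the multiplier leg of the reflected axis is now the FIRST leg `(x, inr α)`, so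
the generator's `q¹` letter and its pure-gauge response (`sum_div_linKerAt_blk`) sit on `x`, the face letter on the second leg `z`; same hypotheses
(H0) packing support (now in the first leg), (H1) reflection law, (H2) block Ward law at these entries, `s·γ₀ = −½`.  No statement of Bałaban's
papers, no `[cite:]`, no `def`; instantiates NO binder of the β-function wall (0/4: hW, hR, D1Tel, D1Rep); NOT hW, NOT hR, NOT D1, NOT `BetaPertH`,
NOT continuum, NOT Clay.
HONEST DEPENDENCY: continuum YM on T⁴ ⇐ BetaPertH ∧ nine spine estimates (0/9 proved); BetaPertH ⇐ (D1) ∧ (D4) ∧ CAP+tail;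
G-an2-4 gates asym, D1 and NE2/3/4.

CONTENT (generic `d`, odd `Lc`, centred root): `ctGen_diff_axis'`, `divV_canonD_inr_inl_axis` (per site), **`canonD_ward_eq_defect_inr_inl_axis`**.
With parts 2a∕2a′∕2b this COMPLETES the abstract consistency identity `W_Y(B_α) = G_α` on all four border blocks
`(inl β, inr m)`, `(inr m, inl β)`, `m = α` and `m ≠ α`; the wall instances and the assembled kernel statement follow in part 2d.
Provenance: β sub-cell, D1 formalisation swarm, unit b2b-balaban-beta-d1-formalise-leaf-04 gen 4, 2026-08-20 (v1); no existing file touched.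
-/

open Finset
open scoped BigOperators
open Literature.MathematicalPhysics.QuantumFieldTheory
open Literature.MathematicalPhysics.QuantumFieldTheory.Balaban1983to89
open Literature.MathematicalPhysics.QuantumFieldTheory.Balaban1983to89.Beta
open ExpKernelCalculus (MKer)
open AffineAveraging (box toSite)
open AveragingContours (blk off)
open AveragingContoursRooted (ctr ctrOff)
open AveragingHessianKernelsRooted (linKerAt)
open KernelWard (divV)
open PolarizationSign (reflSign)
open KernelReflection (LegMap refK refK_apply)
open ResolventReflection (sref sref_sref bref mref Φ Φ_r_inl Φ_r_inr Φ_s_inl Φ_s_inr)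
open OneStepResolventKernel (Fib)
open Summit.QuantumFields.BalabanUV.Beta.TameKernelCalculus
open Summit.QuantumFields.BalabanUV.Beta.ChartConjugation (conjV)
open Summit.QuantumFields.BalabanUV.Beta.BorderedHessian (diagK diagK_apply conjV_diagK_apply ctGen ctGen_inl ctGen_inr)
open Summit.QuantumFields.BalabanUV.Beta.AveragingWardRootedStencils (legSite legInd legInd_inl legInd_inr)
open Summit.QuantumFields.BalabanUV.Beta.SecondOrderBorderGauge (actS actS_apply canonD canonD_apply)
open Summit.QuantumFields.BalabanUV.Beta.WardBorderReflectionContact (sref_bref_of_ne sref_bref_self blockInd_sref dSym_inl dSym_inr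
  sum_fieldLetter_div)
open Summit.QuantumFields.BalabanUV.Beta.WardBorderReflectionContactAxis (sref_mref_self_add_ctr sum_div_linKerAt_blk)

namespace Summit.QuantumFields.BalabanUV.Beta.WardBorderReflectionContactAxisMirror

noncomputable section

variable {d : ℕ} (Lc : ℕ) (α : Fin (d + 1)) (γ₀ s : ℝ) (𝕄 : MKer (d + 1) (Fib d))
  (S : Fin (d + 1) → (Fin (d + 1) → ℤ) → MKer (d + 1) (Fib d))

/-- [folklore] The generator's difference symbol at the mirror entry `(x, inr α; z, inl β)`: MINUS (the `inl` letter on `z` minus the packed `q¹` letter on `x`). -/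
theorem ctGen_diff_axis' (κ : Fin (d + 1)) (u x z : Fin (d + 1) → ℤ) (β : Fin (d + 1)) :
    γ₀ * ctGen d α Lc κ u z (Sum.inl β) - γ₀ * ctGen d α Lc κ u x (Sum.inr α) =
      -(γ₀ * ((if z = u ∧ β = κ ∧ κ = α then (1 : ℝ) else 0) -
        (if off Lc x = 0 then (1 : ℝ) else 0) * linKerAt (ctr (d + 1) Lc) Lc α (blk Lc x) (κ, u))) := by
  rw [ctGen_inr, ctGen_inl]
  by_cases hx : off Lc x = 0
  · have hc : (α = α ∧ off Lc x = 0) := ⟨rfl, hx⟩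
    rw [if_pos hc, if_pos hx]; split_ifs <;> ring
  · have hc : ¬(α = α ∧ off Lc x = 0) := fun h => hx h.2
    rw [if_neg hc, if_neg hx]; split_ifs <;> ring

/-- [folklore] **THE DIVERGENCE OF THE CANONICAL CONTACT AT ONE SITE**, mirror axis entry `(x, inr α; z, inl β)`. -/
theorem divV_canonD_inr_inl_axis (κ' : Fin (d + 1)) (u' y x z : Fin (d + 1) → ℤ) (β : Fin (d + 1)) :
    divV (fun κ u => canonD 𝕄 S (fun κ u p c => γ₀ * ctGen d α Lc κ u p c) κ u κ' u') y x z (Sum.inr α) (Sum.inl β) =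
      -(γ₀ * S κ' u' x z (Sum.inr α) (Sum.inl β) *
          ((if β = α then ((if z + B6BondElimination.unitVec α = y then (1 : ℝ) else 0) - (if z = y then 1 else 0)) else 0) -
            (if off Lc x = 0 then (1 : ℝ) else 0) * ∑ κ : Fin (d + 1),
              (linKerAt (ctr (d + 1) Lc) Lc α (blk Lc x) (κ, y - B6BondElimination.unitVec κ) -
                linKerAt (ctr (d + 1) Lc) Lc α (blk Lc x) (κ, y)))) -
        γ₀ * ((if z = u' ∧ β = κ' ∧ κ' = α then (1 : ℝ) else 0) -
            (if off Lc x = 0 then (1 : ℝ) else 0) * linKerAt (ctr (d + 1) Lc) Lc α (blk Lc x) (κ', u')) *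
          divV S y x z (Sum.inr α) (Sum.inl β) +
        γ₀ ^ 2 * ((if z = u' ∧ β = κ' ∧ κ' = α then (1 : ℝ) else 0) -
            (if off Lc x = 0 then (1 : ℝ) else 0) * linKerAt (ctr (d + 1) Lc) Lc α (blk Lc x) (κ', u')) * 𝕄 x z (Sum.inr α) (Sum.inl β) *
          ((if β = α then ((if z + B6BondElimination.unitVec α = y then (1 : ℝ) else 0) - (if z = y then 1 else 0)) else 0) -
            (if off Lc x = 0 then (1 : ℝ) else 0) * ∑ κ : Fin (d + 1),
              (linKerAt (ctr (d + 1) Lc) Lc α (blk Lc x) (κ, y - B6BondElimination.unitVec κ) -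
                linKerAt (ctr (d + 1) Lc) Lc α (blk Lc x) (κ, y))) := by
  have e : ∀ κ : Fin (d + 1), ∀ u : Fin (d + 1) → ℤ,
      canonD 𝕄 S (fun κ u p c => γ₀ * ctGen d α Lc κ u p c) κ u κ' u' x z (Sum.inr α) (Sum.inl β) =
        -(γ₀ * S κ' u' x z (Sum.inr α) (Sum.inl β) * ((if z = u ∧ β = κ ∧ κ = α then (1 : ℝ) else 0) -
            (if off Lc x = 0 then (1 : ℝ) else 0) * linKerAt (ctr (d + 1) Lc) Lc α (blk Lc x) (κ, u))) -
          γ₀ * ((if z = u' ∧ β = κ' ∧ κ' = α then (1 : ℝ) else 0) -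
              (if off Lc x = 0 then (1 : ℝ) else 0) * linKerAt (ctr (d + 1) Lc) Lc α (blk Lc x) (κ', u')) *
            S κ u x z (Sum.inr α) (Sum.inl β) +
          γ₀ ^ 2 * ((if z = u' ∧ β = κ' ∧ κ' = α then (1 : ℝ) else 0) -
              (if off Lc x = 0 then (1 : ℝ) else 0) * linKerAt (ctr (d + 1) Lc) Lc α (blk Lc x) (κ', u')) * 𝕄 x z (Sum.inr α) (Sum.inl β) *
            ((if z = u ∧ β = κ ∧ κ = α then (1 : ℝ) else 0) -
              (if off Lc x = 0 then (1 : ℝ) else 0) * linKerAt (ctr (d + 1) Lc) Lc α (blk Lc x) (κ, u)) := by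
    intro κ u
    rw [canonD_apply, ctGen_diff_axis', ctGen_diff_axis']
    ring
  simp only [KernelWard.divV, Finset.sum_apply, Pi.sub_apply, e]
  rw [← sum_fieldLetter_div α z y β]
  simp only [mul_sub, sub_mul, neg_sub, Finset.mul_sum]
  simp only [← Finset.sum_sub_distrib, ← Finset.sum_add_distrib]
  refine Finset.sum_congr rfl fun κ _ => ?_
  ring

/-- [folklore] **THE CONSISTENCY IDENTITY `W_Y(B_α) = G_α` AT THE MIRROR AXIS ENTRIES `(x, inr α; z, inl β)`** for the canonical contact of ANY
first-order datum `(𝕄, S)` obeying (H0) packing support in the first (multiplier) leg, (H1) the reflection law, (H2) the block Ward law at these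
entries, with `s·γ₀ = −½`, odd `Lc`, centred root. -/
theorem canonD_ward_eq_defect_inr_inl_axis [NeZero Lc] (hLc : Odd Lc) (hs : s * γ₀ = -(1 / 2 : ℝ))
    (h0S : ∀ (κ : Fin (d + 1)) (u x z : Fin (d + 1) → ℤ) (β : Fin (d + 1)), off Lc x ≠ 0 → S κ u x z (Sum.inr α) (Sum.inl β) = 0)
    (h0M : ∀ (x z : Fin (d + 1) → ℤ) (β : Fin (d + 1)), off Lc x ≠ 0 → 𝕄 x z (Sum.inr α) (Sum.inl β) = 0)
    (hlaw : actS Lc α S = fun κ u => S κ u + conjV 𝕄 (diagK fun p c => γ₀ * ctGen d α Lc κ u p c))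
    (hward : ∀ (Y x z : Fin (d + 1) → ℤ) (β : Fin (d + 1)),
      (∑ v ∈ box (d + 1) Lc, divV S ((Lc : ℤ) • Y + toSite v)) x z (Sum.inr α) (Sum.inl β) =
        ((-2 * γ₀) • conjV 𝕄 (diagK ((1 / 2 : ℝ) • ∑ v ∈ box (d + 1) Lc,
          legInd (toSite (ctrOff (d + 1) Lc)) ((Lc : ℤ) • Y + toSite v)))) x z (Sum.inr α) (Sum.inl β))
    (Y : Fin (d + 1) → ℤ) (κ' : Fin (d + 1)) (u' x z : Fin (d + 1) → ℤ) (β : Fin (d + 1)) :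
    (s • ∑ v ∈ box (d + 1) Lc, divV (fun κ u => canonD 𝕄 S (fun κ u p c => γ₀ * ctGen d α Lc κ u p c) κ u κ' u')
        ((Lc : ℤ) • Y + toSite v)) x z (Sum.inr α) (Sum.inl β) =
      (reflSign α κ' • refK (Φ (d := d) Lc α) (conjV (S κ' (bref α κ' u'))
          (diagK ((1 / 2 : ℝ) • ∑ v ∈ box (d + 1) Lc, legInd (toSite (ctrOff (d + 1) Lc)) ((Lc : ℤ) • sref α Y + toSite v)))) -
        conjV (S κ' u') (diagK ((1 / 2 : ℝ) • ∑ v ∈ box (d + 1) Lc, legInd (toSite (ctrOff (d + 1) Lc)) ((Lc : ℤ) • Y + toSite v))))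
        x z (Sum.inr α) (Sum.inl β) := by
  set ρ : Fin (d + 1) → ℤ := toSite (ctrOff (d + 1) Lc) with hρ
  set A : ℝ := S κ' u' x z (Sum.inr α) (Sum.inl β) with hA
  set M : ℝ := 𝕄 x z (Sum.inr α) (Sum.inl β) with hM
  set Nz : ℝ := ∑ v ∈ box (d + 1) Lc, (if z = (Lc : ℤ) • Y + toSite v then (1 : ℝ) else 0) with hNz
  set Nze : ℝ := ∑ v ∈ box (d + 1) Lc, (if z + B6BondElimination.unitVec α = (Lc : ℤ) • Y + toSite v then (1 : ℝ) else 0) with hNze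
  set Nx : ℝ := ∑ v ∈ box (d + 1) Lc, (if x + ρ = (Lc : ℤ) • Y + toSite v then (1 : ℝ) else 0) with hNx
  set Nxf : ℝ := ∑ v ∈ box (d + 1) Lc, (if x + (Lc : ℤ) • B6BondElimination.unitVec α + ρ = (Lc : ℤ) • Y + toSite v then (1 : ℝ) else 0)
    with hNxf
  set c' : ℝ := (if z = u' ∧ β = κ' ∧ κ' = α then (1 : ℝ) else 0) -
    (if off Lc x = 0 then (1 : ℝ) else 0) * linKerAt (ctr (d + 1) Lc) Lc α (blk Lc x) (κ', u') with hc'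
  -- (H1) at this entry
  have hlaw_e : reflSign α κ' * (reflSign α α * reflSign α β *
      S κ' (bref α κ' u') (mref Lc α α x) (bref α β z) (Sum.inr α) (Sum.inl β)) = A + M * -(γ₀ * c') := by
    have e := congrFun (congrFun (congrFun (congrFun (congrFun (congrFun hlaw κ') u') x) z) (Sum.inr α)) (Sum.inl β)
    rw [actS_apply, Φ_s_inl, Φ_s_inr, Φ_r_inl, Φ_r_inr] at e
    rw [e, Pi.add_apply, Pi.add_apply, Pi.add_apply, Pi.add_apply, conjV_diagK_apply, ctGen_diff_axis']
  -- the reflected symbols of `D`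
  have hDx : ((1 / 2 : ℝ) • ∑ v ∈ box (d + 1) Lc, legInd ρ ((Lc : ℤ) • sref α Y + toSite v)) (mref Lc α α x) (Sum.inr α) =
      (1 / 2 : ℝ) * Nxf := by
    rw [dSym_inr, blockInd_sref, sref_mref_self_add_ctr α hLc]
  have hDz : ((1 / 2 : ℝ) • ∑ v ∈ box (d + 1) Lc, legInd ρ ((Lc : ℤ) • sref α Y + toSite v)) (bref α β z) (Sum.inl β) =
      (1 / 2 : ℝ) * (if β = α then Nze else Nz) := by
    rw [dSym_inl, blockInd_sref]
    by_cases hβ : β = α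
    · subst hβ; rw [if_pos rfl, sref_bref_self]
    · rw [if_neg hβ, sref_bref_of_ne α hβ]
  have hDx0 : ((1 / 2 : ℝ) • ∑ v ∈ box (d + 1) Lc, legInd ρ ((Lc : ℤ) • Y + toSite v)) x (Sum.inr α) = (1 / 2 : ℝ) * Nx :=
    dSym_inr Lc ρ Y x α
  have hDz0 : ((1 / 2 : ℝ) • ∑ v ∈ box (d + 1) Lc, legInd ρ ((Lc : ℤ) • Y + toSite v)) z (Sum.inl β) = (1 / 2 : ℝ) * Nz :=
    dSym_inl Lc ρ Y z β
  -- (H2) at this entry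
  have hward_e : (∑ v ∈ box (d + 1) Lc, divV S ((Lc : ℤ) • Y + toSite v)) x z (Sum.inr α) (Sum.inl β) =
      (-2 * γ₀) * (M * ((1 / 2 : ℝ) * Nz - (1 / 2 : ℝ) * Nx)) := by
    rw [hward, Pi.smul_apply, Pi.smul_apply, Pi.smul_apply, Pi.smul_apply, smul_eq_mul, conjV_diagK_apply, hDz0, hDx0]
  -- LHS
  have hL : (∑ v ∈ box (d + 1) Lc, divV (fun κ u => canonD 𝕄 S (fun κ u p c => γ₀ * ctGen d α Lc κ u p c) κ u κ' u')
      ((Lc : ℤ) • Y + toSite v)) x z (Sum.inr α) (Sum.inl β) =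
      -(γ₀ * A * ((if β = α then Nze - Nz else 0) - (if off Lc x = 0 then (1 : ℝ) else 0) * (Nxf - Nx))) -
        γ₀ * c' * ((∑ v ∈ box (d + 1) Lc, divV S ((Lc : ℤ) • Y + toSite v)) x z (Sum.inr α) (Sum.inl β)) +
        γ₀ ^ 2 * c' * M * ((if β = α then Nze - Nz else 0) - (if off Lc x = 0 then (1 : ℝ) else 0) * (Nxf - Nx)) := by
    have hFL : ∑ v ∈ box (d + 1) Lc,
        (if β = α then ((if z + B6BondElimination.unitVec α = (Lc : ℤ) • Y + toSite v then (1 : ℝ) else 0) -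
          (if z = (Lc : ℤ) • Y + toSite v then 1 else 0)) else 0) = if β = α then Nze - Nz else 0 := by
      by_cases hβ : β = α
      · simp only [if_pos hβ, Finset.sum_sub_distrib, hNze, hNz]
      · simp only [if_neg hβ, Finset.sum_const_zero]
    have hQ : ∑ v ∈ box (d + 1) Lc, (if off Lc x = 0 then (1 : ℝ) else 0) * ∑ κ : Fin (d + 1),
        (linKerAt (ctr (d + 1) Lc) Lc α (blk Lc x) (κ, (Lc : ℤ) • Y + toSite v - B6BondElimination.unitVec κ) -
          linKerAt (ctr (d + 1) Lc) Lc α (blk Lc x) (κ, (Lc : ℤ) • Y + toSite v)) =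
        (if off Lc x = 0 then (1 : ℝ) else 0) * (Nxf - Nx) := by
      rw [← Finset.mul_sum]
      by_cases hx : off Lc x = 0
      · rw [if_pos hx, one_mul, one_mul]
        exact sum_div_linKerAt_blk (ctr (d + 1) Lc) Lc α hx Y
      · rw [if_neg hx, zero_mul, zero_mul]
    have hBW : ∑ v ∈ box (d + 1) Lc, divV S ((Lc : ℤ) • Y + toSite v) x z (Sum.inr α) (Sum.inl β) =
        (∑ v ∈ box (d + 1) Lc, divV S ((Lc : ℤ) • Y + toSite v)) x z (Sum.inr α) (Sum.inl β) := by
      rw [Finset.sum_apply, Finset.sum_apply, Finset.sum_apply, Finset.sum_apply]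
    rw [Finset.sum_apply, Finset.sum_apply, Finset.sum_apply, Finset.sum_apply]
    simp only [divV_canonD_inr_inl_axis Lc α γ₀ 𝕄 S]
    rw [← hA, ← hM, ← hc', ← hBW, ← hFL, ← hQ]
    simp only [mul_sub, Finset.mul_sum, neg_sub]
    simp only [← Finset.sum_sub_distrib, ← Finset.sum_add_distrib]
  -- assemble
  have hγ : γ₀ ≠ 0 := by
    rintro rfl; norm_num at hs
  have hs' : s = -(1 / 2 : ℝ) / γ₀ := by
    field_simp; linarith [hs]
  rw [Pi.smul_apply, Pi.smul_apply, Pi.smul_apply, Pi.smul_apply, smul_eq_mul, hL, hward_e]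
  rw [Pi.sub_apply, Pi.sub_apply, Pi.sub_apply, Pi.sub_apply, Pi.smul_apply, Pi.smul_apply, Pi.smul_apply, Pi.smul_apply,
    smul_eq_mul, refK_apply, Φ_s_inl, Φ_s_inr, Φ_r_inl, Φ_r_inr, conjV_diagK_apply, conjV_diagK_apply, hDz, hDx, hDz0, hDx0,
    ← hA]
  rw [show reflSign α κ' * (reflSign α α * reflSign α β *
      (S κ' (bref α κ' u') (mref Lc α α x) (bref α β z) (Sum.inr α) (Sum.inl β) * ((1 / 2 : ℝ) * (if β = α then Nze else Nz) - (1 / 2 : ℝ) * Nxf))) =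
      (reflSign α κ' * (reflSign α α * reflSign α β * S κ' (bref α κ' u') (mref Lc α α x) (bref α β z) (Sum.inr α) (Sum.inl β))) *
        ((1 / 2 : ℝ) * (if β = α then Nze else Nz) - (1 / 2 : ℝ) * Nxf) by ring, hlaw_e, hs']
  by_cases hx : off Lc x = 0
  · simp only [if_pos hx]
    by_cases hβ : β = α
    · simp only [if_pos hβ]
      field_simp
      ring
    · simp only [if_neg hβ]
      field_simp
      ring
  · have hA0 : A = 0 := h0S κ' u' x z β hx
    have hM0 : M = 0 := h0M x z β hx
    simp only [if_neg hx, hA0, hM0]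
    ring

end

end Summit.QuantumFields.BalabanUV.Beta.WardBorderReflectionContactAxisMirror
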